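import Mathlib
import HarnessLib
import Summits.NavierStokesRegularity.NavierStokesRegularity.Theorems.UnthreadedDoorCellFluxDefs
import Summits.NavierStokesRegularity.NavierStokesRegularity.Theorems.UnthreadedDoorCellFluxRadialProjection

/-!
# Route `UnthreadedDoor`, crux `PoloidalLiouville` (stmt-NavierStokesRegularity-1222), WALL W1 — crux idea «cell-flux» (ns-idea-14,
# `Cruxes/PoloidalLiouville/CellFluxSketch.lean`): the Σ-4 bridge `netFlux ≤ clusterFlux`

The hidden lemma of Σ-4 `stub_cellTameAnalytic_of_decay` (ns-qj-p1 g7 typing note, 2026-08-29): the rule delivered by Σ-1 depends on the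
time window, so the HH-5 tail (`t₁ ↓ −∞` ⇒ `∫₀ᴿ F ≤ 0`) can only be run on a RULE-INDEPENDENT minorant of the cluster flux — the net flux:
* `constant_of_sphCrit` — if the `y`-level set of `f` in `S_r(x₀)` lies inside an open set on whose trace every point is sphere-critical
  (`∇f × (q − x₀) = 0`), then either `f ≡ y` on the sphere (it is `⟨`nonempty, relatively clopen`⟩` by `exists_ball_eq_of_sphCrit_patch`, the sphere is
  connected);
* `exists_mem_Icc_of_clusterPartition` — on a cluster partition `𝒦 ≠ ∅`, every value of `f` on the sphere lies in some closed class range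
  `[inf_K f, sup_K f]` (otherwise the level set sits inside `Γ ⊆ sphCrit` and `f` would be constant, contradicting the class ranges);
* `sphOsc_le_finsum_setOsc` — `osc_{S_r} f ≤ Σ_{K ∈ 𝒦} osc_K f` (IVT on the connected sphere, the class ranges cover `[min f, max f]`, Lebesgue
  measure of a finite cover); **`netFlux_le_clusterFlux`** — `netFlux f x₀ r ≤ clusterFlux f r 𝒦` for EVERY cluster partition (`r > 0`,
  `f ∈ C¹({x₀}ᶜ)`).
With it Σ-4 is the HH-5 re-run verbatim (`∫₀ᴿ netFlux ≤ ∫₀ᴿ clusterFlux(𝒞_{t₀}) ≤ A·N₀·C₁(1+R/√−t)³(t/t₁)^λ → 0`, then ARM A's p660934 tail).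
HONEST LABEL: support calculus; `PoloidalLiouville` (1222), W1 and the summit stay OPEN; NO Navier–Stokes regularity statement is proved.
`--supports stmt-NavierStokesRegularity-1222 --as helper`.  [folklore]
-/

noncomputable section

-- the summit and its single sub-problem share the name (CONVENTIONS §1)
set_option linter.dupNamespace false

open Set Function Filter Topology InnerProductSpace Metric MeasureTheory
open scoped RealInnerProductSpace ENNReal

namespace Summit.NavierStokesRegularity.NavierStokesRegularity.Theorems.PoloidalLiouville.CellFlux

open Literature.Analysis Literature.Analysis.FluidPDE
open Summit.NavierStokesRegularity.NavierStokesRegularity.Theorems.PoloidalLiouville.NetFlux (E3 sphSup sphInf sphOsc netFlux)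

/-- The sphere of `ℝ³` is preconnected. [folklore] -/
theorem isPreconnected_sphere_E3 (x₀ : E3) (r : ℝ) : IsPreconnected (sphere x₀ r) := by
  have hrank : 1 < Module.rank ℝ E3 := by
    rw [← Module.finrank_eq_rank, finrank_euclideanSpace_fin]
    norm_num
  exact isPreconnected_sphere hrank x₀ r

/-- **Constancy from a critical envelope of a level set.**  `f ∈ C¹({x₀}ᶜ)`, `r > 0`, `V` open with `∇f(q) × (q − x₀) = 0` for all `q ∈ S_r ∩ V`,
and the whole `y`-level set of `f|_{S_r}` inside `V`, with `f p = y` for some `p ∈ S_r`: then `f ≡ y` on `S_r(x₀)`. [folklore] -/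
theorem constant_of_sphCrit {f : E3 → ℝ} {x₀ : E3} {r y : ℝ} (hr : 0 < r) (hf : ContDiffOn ℝ 1 f ({x₀}ᶜ : Set E3))
    {V : Set E3} (hV : IsOpen V) (hcrit : ∀ q ∈ sphere x₀ r ∩ V, cross (gradient f q) (q - x₀) = 0)
    (hZ : ∀ q ∈ sphere x₀ r, f q = y → q ∈ V) {p : E3} (hp : p ∈ sphere x₀ r) (hpy : f p = y) :
    ∀ q ∈ sphere x₀ r, f q = y := by
  classical
  by_contra hcon
  push Not at hcon
  obtain ⟨q₁, hq₁, hq₁y⟩ := hcon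
  -- radii of constancy around the points of the level set
  have hball : ∀ q ∈ sphere x₀ r, f q = y → ∃ ε > 0, ∀ q' ∈ sphere x₀ r, dist q' q < ε → f q' = f q := fun q hq hqy =>
    exists_ball_eq_of_sphCrit_patch hr hf hV hcrit ⟨hq, hZ q hq hqy⟩
  choose! ε hε hεeq using hball
  set O₁ : Set E3 := ⋃ q ∈ {q | q ∈ sphere x₀ r ∧ f q = y}, ball q (ε q) with hO₁
  have hO₁o : IsOpen O₁ := isOpen_biUnion fun q _ => isOpen_ball
  -- the complement of the level set, as an open set of `ℝ³` off the centre
  have hsph : sphere x₀ r ⊆ ({x₀}ᶜ : Set E3) := fun z hz => ne_of_mem_sphere hz hr.ne'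
  have hO₂o : IsOpen (({x₀}ᶜ : Set E3) ∩ f ⁻¹' ({y}ᶜ : Set ℝ)) :=
    hf.continuousOn.isOpen_inter_preimage isOpen_compl_singleton isOpen_compl_singleton
  have hcover : sphere x₀ r ⊆ O₁ ∪ (({x₀}ᶜ : Set E3) ∩ f ⁻¹' ({y}ᶜ : Set ℝ)) := by
    intro q hq
    by_cases hqy : f q = y
    · left
      rw [hO₁, mem_iUnion₂]
      exact ⟨q, ⟨hq, hqy⟩, mem_ball_self (hε q hq hqy)⟩
    · right
      exact ⟨hsph hq, hqy⟩
  have hne₁ : (sphere x₀ r ∩ O₁).Nonempty := ⟨p, hp, by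
    rw [hO₁, mem_iUnion₂]; exact ⟨p, ⟨hp, hpy⟩, mem_ball_self (hε p hp hpy)⟩⟩
  have hne₂ : (sphere x₀ r ∩ (({x₀}ᶜ : Set E3) ∩ f ⁻¹' ({y}ᶜ : Set ℝ))).Nonempty := ⟨q₁, hq₁, hsph hq₁, hq₁y⟩
  obtain ⟨q, hqS, hqO₁, hqO₂⟩ := isPreconnected_sphere_E3 x₀ r _ _ hO₁o hO₂o hcover hne₁ hne₂
  rw [hO₁, mem_iUnion₂] at hqO₁
  obtain ⟨q₀, ⟨hq₀, hq₀y⟩, hqq₀⟩ := hqO₁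
  have : f q = y := by rw [hεeq q₀ hq₀ hq₀y q hqS (mem_ball.1 hqq₀), hq₀y]
  exact hqO₂.2 this

/-- **Every value on the sphere lies in a class range.**  For a NONEMPTY cluster partition `𝒦` of `S_r ∖ Γ` (`r > 0`, `f ∈ C¹({x₀}ᶜ)`) and any
`p ∈ S_r(x₀)`, some class `K` has `sInf (f '' K) ≤ f p ≤ sSup (f '' K)`. [folklore] -/
theorem exists_mem_Icc_of_clusterPartition {f : E3 → ℝ} {x₀ : E3} {r : ℝ} {𝒦 : Set (Set E3)} (hr : 0 < r)
    (hf : ContDiffOn ℝ 1 f ({x₀}ᶜ : Set E3)) (hpart : IsClusterPartition f x₀ r 𝒦) (hne : 𝒦.Nonempty)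
    {p : E3} (hp : p ∈ sphere x₀ r) : ∃ K ∈ 𝒦, f p ∈ Icc (sInf (f '' K)) (sSup (f '' K)) := by
  obtain ⟨hfin, hcls, hcover, -⟩ := hpart
  by_contra hcon
  push Not at hcon
  -- continuity and boundedness on the sphere
  have hsph : sphere x₀ r ⊆ ({x₀}ᶜ : Set E3) := fun z hz => ne_of_mem_sphere hz hr.ne'
  have hfc : ContinuousOn f (sphere x₀ r) := hf.continuousOn.mono hsph
  have hcpt : IsCompact (f '' sphere x₀ r) := (isCompact_sphere x₀ r).image_of_continuousOn hfc
  have hKsub : ∀ K ∈ 𝒦, K ⊆ sphere x₀ r := fun K hK z hz => by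
    have : z ∈ ⋃₀ 𝒦 := mem_sUnion.2 ⟨K, hK, hz⟩
    rw [hcover] at this
    exact this.1
  have hbA : ∀ K ∈ 𝒦, BddAbove (f '' K) := fun K hK => hcpt.bddAbove.mono (image_mono (hKsub K hK))
  have hbB : ∀ K ∈ 𝒦, BddBelow (f '' K) := fun K hK => hcpt.bddBelow.mono (image_mono (hKsub K hK))
  -- the open set of non-class values, pulled back
  set W : Set ℝ := (⋃ K ∈ 𝒦, Icc (sInf (f '' K)) (sSup (f '' K)))ᶜ with hW
  have hWo : IsOpen W := by
    rw [hW, isOpen_compl_iff]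
    exact hfin.isClosed_biUnion fun K _ => isClosed_Icc
  set V : Set E3 := ({x₀}ᶜ : Set E3) ∩ f ⁻¹' W with hVdef
  have hVo : IsOpen V := hf.continuousOn.isOpen_inter_preimage isOpen_compl_singleton hWo
  -- values in `W` are not taken on any class, so `S ∩ V ⊆ Γ ⊆ sphCrit`
  have hnotK : ∀ q ∈ sphere x₀ r, f q ∈ W → ∀ K ∈ 𝒦, q ∉ K := by
    intro q _ hqW K hK hqK
    have h1 : f q ∈ Icc (sInf (f '' K)) (sSup (f '' K)) :=
      ⟨csInf_le (hbB K hK) ⟨q, hqK, rfl⟩, le_csSup (hbA K hK) ⟨q, hqK, rfl⟩⟩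
    rw [hW, mem_compl_iff, mem_iUnion₂] at hqW
    exact hqW ⟨K, hK, h1⟩
  have hcrit : ∀ q ∈ sphere x₀ r ∩ V, cross (gradient f q) (q - x₀) = 0 := by
    rintro q ⟨hqS, -, hqW⟩
    have hqΓ : q ∈ sheetTrace f x₀ r := by
      by_contra hΓ
      have : q ∈ ⋃₀ 𝒦 := by rw [hcover]; exact ⟨hqS, hΓ⟩
      obtain ⟨K, hK, hqK⟩ := mem_sUnion.1 this
      exact hnotK q hqS hqW K hK hqK
    exact hqΓ.1.2
  have hpW : f p ∈ W := by
    rw [hW, mem_compl_iff, mem_iUnion₂]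
    rintro ⟨K, hK, hK'⟩
    exact hcon K hK hK'
  have hZ : ∀ q ∈ sphere x₀ r, f q = f p → q ∈ V := fun q hq hqy => ⟨hsph hq, by rw [mem_preimage, hqy]; exact hpW⟩
  have hall := constant_of_sphCrit hr hf hVo hcrit hZ hp rfl
  -- but a class is nonempty and its values are class values
  obtain ⟨K, hK⟩ := hne
  obtain ⟨q, hqK⟩ := (hcls K hK).1
  have hqS := hKsub K hK hqK
  exact hnotK q hqS (by rw [hall q hqS]; exact hpW) K hK hqK

/-- **`osc_{S_r} f ≤ Σ_K osc_K f`** for every cluster partition of `S_r(x₀) ∖ Γ` (`r > 0`, `f ∈ C¹({x₀}ᶜ)`). [folklore] -/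
theorem sphOsc_le_finsum_setOsc {f : E3 → ℝ} {x₀ : E3} {r : ℝ} {𝒦 : Set (Set E3)} (hr : 0 < r)
    (hf : ContDiffOn ℝ 1 f ({x₀}ᶜ : Set E3)) (hpart : IsClusterPartition f x₀ r 𝒦) :
    sSup (f '' sphere x₀ r) - sInf (f '' sphere x₀ r) ≤ ∑ᶠ K ∈ 𝒦, setOsc f K := by
  classical
  have hfin := hpart.1
  have hcls := hpart.2.1
  have hcover := hpart.2.2.1
  have hsph : sphere x₀ r ⊆ ({x₀}ᶜ : Set E3) := fun z hz => ne_of_mem_sphere hz hr.ne'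
  have hfc : ContinuousOn f (sphere x₀ r) := hf.continuousOn.mono hsph
  have hSne : (sphere x₀ r).Nonempty := (NormedSpace.sphere_nonempty).2 hr.le
  have hcpt : IsCompact (f '' sphere x₀ r) := (isCompact_sphere x₀ r).image_of_continuousOn hfc
  have himne : (f '' sphere x₀ r).Nonempty := hSne.image f
  obtain ⟨pa, hpa, hfa⟩ := (mem_image _ _ _).1 (hcpt.sInf_mem himne)
  obtain ⟨pb, hpb, hfb⟩ := (mem_image _ _ _).1 (hcpt.sSup_mem himne)
  have hKsub : ∀ K ∈ 𝒦, K ⊆ sphere x₀ r := fun K hK z hz => by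
    have : z ∈ ⋃₀ 𝒦 := mem_sUnion.2 ⟨K, hK, hz⟩
    rw [hcover] at this
    exact this.1
  have hbA : ∀ K ∈ 𝒦, BddAbove (f '' K) := fun K hK => hcpt.bddAbove.mono (image_mono (hKsub K hK))
  have hbB : ∀ K ∈ 𝒦, BddBelow (f '' K) := fun K hK => hcpt.bddBelow.mono (image_mono (hKsub K hK))
  have hosc0 : ∀ K ∈ 𝒦, 0 ≤ setOsc f K := fun K hK => by
    obtain ⟨q, hq⟩ := (hcls K hK).1
    have h1 : f q ≤ sSup (f '' K) := le_csSup (hbA K hK) ⟨q, hq, rfl⟩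
    have h2 : sInf (f '' K) ≤ f q := csInf_le (hbB K hK) ⟨q, hq, rfl⟩
    unfold setOsc; linarith
  rcases 𝒦.eq_empty_or_nonempty with h𝒦 | hne
  · -- no classes: the whole sphere is sphere-critical, `f` is constant on it
    have hcrit : ∀ q ∈ sphere x₀ r ∩ (univ : Set E3), cross (gradient f q) (q - x₀) = 0 := by
      rintro q ⟨hqS, -⟩
      have hqΓ : q ∈ sheetTrace f x₀ r := by
        by_contra hΓ
        have : q ∈ ⋃₀ 𝒦 := by rw [hcover]; exact ⟨hqS, hΓ⟩
        rw [h𝒦, sUnion_empty] at this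
        exact this
      exact hqΓ.1.2
    have hall := constant_of_sphCrit hr hf isOpen_univ hcrit (fun q _ _ => mem_univ q) hpa rfl
    have hab : sSup (f '' sphere x₀ r) = sInf (f '' sphere x₀ r) := by rw [← hfb, hall pb hpb, hfa]
    rw [hab, sub_self, h𝒦]
    simp
  · -- the class ranges cover `[min, max]`
    have hIVT : Icc (f pa) (f pb) ⊆ f '' sphere x₀ r :=
      (isPreconnected_sphere_E3 x₀ r).intermediate_value hpa hpb hfc
    have hcov : Icc (sInf (f '' sphere x₀ r)) (sSup (f '' sphere x₀ r)) ⊆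
        ⋃ K ∈ hfin.toFinset, Icc (sInf (f '' K)) (sSup (f '' K)) := by
      intro y hy
      rw [← hfa, ← hfb] at hy
      obtain ⟨p, hp, hpy⟩ := hIVT hy
      obtain ⟨K, hK, hKy⟩ := exists_mem_Icc_of_clusterPartition hr hf hpart hne hp
      rw [mem_iUnion₂]
      exact ⟨K, hfin.mem_toFinset.2 hK, hpy ▸ hKy⟩
    -- Lebesgue measure of the finite cover
    have hμ : volume (Icc (sInf (f '' sphere x₀ r)) (sSup (f '' sphere x₀ r))) ≤
        ∑ K ∈ hfin.toFinset, volume (Icc (sInf (f '' K)) (sSup (f '' K))) :=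
      (measure_mono hcov).trans (measure_biUnion_finset_le _ _)
    rw [Real.volume_Icc] at hμ
    simp only [Real.volume_Icc] at hμ
    have hosc0' : ∀ K ∈ hfin.toFinset, 0 ≤ sSup (f '' K) - sInf (f '' K) := fun K hK => by
      have := hosc0 K (hfin.mem_toFinset.1 hK)
      unfold setOsc at this
      exact this
    rw [← ENNReal.ofReal_sum_of_nonneg hosc0'] at hμ
    have hle := (ENNReal.ofReal_le_ofReal_iff (Finset.sum_nonneg hosc0')).1 hμ
    rw [finsum_mem_eq_finite_toFinset_sum _ hfin]
    unfold setOsc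
    exact hle

/-- **The Σ-4 bridge: `netFlux ≤ clusterFlux`** for every cluster partition (`r > 0`, `f ∈ C¹({x₀}ᶜ)`). [folklore] -/
theorem netFlux_le_clusterFlux {f : E3 → ℝ} {x₀ : E3} {r : ℝ} {𝒦 : Set (Set E3)} (hr : 0 < r)
    (hf : ContDiffOn ℝ 1 f ({x₀}ᶜ : Set E3)) (hpart : IsClusterPartition f x₀ r 𝒦) :
    netFlux f x₀ r ≤ clusterFlux f r 𝒦 := by
  unfold netFlux clusterFlux sphOsc sphSup sphInf
  exact mul_le_mul_of_nonneg_left (sphOsc_le_finsum_setOsc hr hf hpart) hr.le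

end Summit.NavierStokesRegularity.NavierStokesRegularity.Theorems.PoloidalLiouville.CellFlux

end
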